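import Literature.MathematicalPhysics.QuantumFieldTheory.Balaban1983to89.B8Eq131Derivation
import Literature.MathematicalPhysics.QuantumFieldTheory.Balaban1983to89.B7Eq123General
import Literature.MathematicalPhysics.QuantumFieldTheory.Balaban1983to89.B7BlockAvgLog
import Literature.MathematicalPhysics.QuantumFieldTheory.Balaban1983to89.B8Eq146AExpansion
import Literature.MathematicalPhysics.QuantumFieldTheory.Balaban1983to89.B8Eq156Prop4

/-!
# `Balaban1983to89.B8Eq137QjEqB` — [Balaban1985RegularSpaces] Theorem 2, the FIRST HALF of the line (1.37) p. 82:
# «Q_j(U₀, ηA) = B on Λ_j, … B is given by formula (1.31) with V′ = Ũ′ʲ» — [3]'s composite (127) `Q_j(U₀, ηA)` EQUALS the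
# configuration `B` of (1.31), kernel-checked on the `ℤᵈ` carriers of the lineage (the clause `B8Thm2LogB` HONEST SCOPE (iv)
# left schematic), with the (1.42) clause «|Q_j(U₀, ηA)| < 2dLα₁» as a corollary of (1.35)

statement-level skeleton of published theorems with citation tags; proofs where landed; nothing here is a claim
about the Yang–Mills mass gap

PDF held: `paper:balaban1985-cmp99-regular-spaces-gauge-fixing` (journal page = PDF page + 74); pages read for this module:
p. 82 [PDF 8] AS AN IMAGE (render `run/shared/lean/pub/pub-balaban/b2b-balaban-ref1/pages/1985-cmp99-regular-spaces-gauge-fixing/…-p008-x2.png`,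
this session), p. 83 [PDF 9] and p. 86 [PDF 12] from the `lit read` text layer; [3] = T. Bałaban, *Averaging operations for
lattice gauge theories*, Commun. Math. Phys. **98** (1985) 17–51 [Balaban1985Averaging] (127) p. 37, p. 38 (the sentence before
(133)), (121) p. 36, (90)–(92) p. 31 — through the tree modules `B7Prop4GeneralLevels` / `B7Eq123General` / `B7Eq92Concrete`,
whose headers quote the renders.

CITATION HEADER (lean-in-tree rule).  Cell `lit-balaban` (HOME `run/shared/lean/pub/lit-balaban/`), unit `lit-balaban-r05`
gen 12 (B8 fold owner).  WHAT IS REPRODUCED = SKELETON rows **B8.Eq1.36** ((1.36)–(1.39), the (1.37) line) and **B8.Eq1.31**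
((1.30)–(1.31), the configuration `B`), cross-reference **B8.Eq1.56** (p. 86, whose tree theorems take (1.42)'s clause
«|Q_j(U₀, ηA)| < 2dLα₁» as the hypothesis `h42` of `B8Eq156Prop4.norm_B1_lt`).  Status before this module: the parent
`B8Eq131Derivation` (r05 g5, p248065/p248309/p248391) certifies `exp iB_b = (Ū₁ʲ)_b` and `|B_b| < 2dLα₁` on the certified
averages (`eq137_interior`/`eq137_crossing`), and its grand-parent `B8Thm2LogB` records in HONEST SCOPE (iv): *"`Q_j(U₀, ηA) = B`
(the first half of the (1.37) line) is the definition of `Q_j` composed with (1.31) and B7 (92) — not typed here"*.  THIS MODULE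
TYPES AND PROVES IT: print's `Q_j(U₀, ηA)` is [3]'s composite (127), in the tree `B7Prop4GeneralLevels.logCovIter L U₀ B₀ j`
(the `i`-multiplied object, `B₀ = iηA`, lineage convention), and at every bond of `Λ_j` where the parent's (87)-hypotheses
hold it EQUALS `i·B_b` for the `B_b` of (1.31) (`B8Thm2LogB.Bint` / `Bcross` / `BcrossMirror`) — EXACTLY, as elements of
the algebra, given [3]'s identification (127) `U̿₁ʲ = exp Q_j(U₀, ηA)` one level down (`B7Eq123General.dbavgCovIter_eq_expCfg_logCovIter`,
p06 g2, itself unconditional in [3] Prop. 4's regime).  Kind «kernel-checked proof», theorems only; no `… : Prop` fact, no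
definition; no existing module is modified; REUSED BY NAME: `B8Eq131Derivation.eq130_interior/eq131_crossing/
eq131_crossing_mirrored/eq137_interior/eq137_crossing`, `B8Thm2LogB.Bint/Bcross/BcrossMirror/ineq137_crossing_mirrored`,
`B7Prop4GeneralLevels.logCovIter`, `B7Prop3GeneralLinear.Qcov`, `B7Eq92Concrete.dbavgCovIter`,
`B7Eq123General.dbavgCovIter_eq_expCfg_logCovIter/level_data`, `B7BlockAvgLog.mlog_exp`, `B8Eq146AExpansion.iEta`,
`B8Eq156Prop4.norm_B1_lt`.

WHAT IS PRINTED (p. 82 [PDF 8], verbatim from the render).  *"(Ū₁ʲ)_b = V′_b = exp iB_b, if b ⊂ Λ_j (i.e., b₋, b₊ ∈ Λ_j),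
(Ū₁ʲ)_b = exp[−i Σ_{x∈B(b₋)} L^{−d} (1/i) log(R̄^{j−1}_{0,b₋}V′)(Γ_{b₋,x})] V′_b = exp iB_b, if b₋ ∈ Λ_{j−1}, b₊ ∈ Λ_j, (1.31)
or (1/i) log Ū₁ʲ = B on Λ_j, j = 0, 1, …, k, where the configuration B is defined by the above equations."* and, in the list
of conditions Theorem 2 constructs, *"Q_j(U₀, ηA) = B on Λ_j, j = 0, 1, …, k, B is given by formula (1.31) with V′ = Ũ′ʲ,
|B| < 2dLα₁ by the assumption (1.35), (1.37)"*; p. 83 [PDF 9]: *"Also the condition (1.37) is basically of an algebraic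
character and it follows from the construction, as in (1.30), (1.31). The only fact we need to write it this way is the
representation of U₁ and the first condition on A in (1.36)."* and (1.42) *"R(U₀)D^{η*}_{U₀}A = 0, Q_j(U₀, ηA) = B on Λ_j,
|B| < 2dLα₁"*.  [3] p. 37 (127) (quoted in `B7Prop4GeneralLevels`): *"(1/i) log U̿₁ᵏ as a function of (1/i) log U₁ is a
composition of the functions Q(U₀, ·), Q(Ū₀, ·), …, Q(Ū₀^{k−1}, ·)"*, p. 38: *"denoting Q_{j+1}(U₀, ηA) = Q(Ū₀ʲ, Q_j(U₀, ηA))"*.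

DICTIONARY (the `ℤᵈ` model of the two parent lineages; nothing new).  Sites `Site d = ℤᵈ`; a level-`j` bond of `Λ_j` ↦ a
pair `(y, κ)` read on the unit lattice after `j` rescalings; `U₀, U₁ : Site d → Fin d → 𝔸ˣ` over a complete normed `ℂ`-algebra
`𝔸` with `‖1‖ = 1`; the gauge transformation `u : Site d → 𝔸ˣ`, `U′ = U₁ᵘ = B7Eq92Concrete.mgauge U₀ u U₁` ((1.17)/(55)), so
that `U₁ = U′^{u⁻¹}` as in print; «the representation of U₁» `U₁ = e^{iηA}` ↦ `U₁ = B7Prop3Flat.expCfg B₀`, `B₀ = iηA =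
B8Eq146AExpansion.iEta η A` (the lineage absorbs `i` and `η` into the exponent field); print's `Q_j(U₀, ηA)` ↦
`(1/i)·logCovIter L U₀ B₀ j` ([3] (127), each factor the one-step map (121) `Qcov = log ∘ (double-bar average) ∘ exp`);
`Ũ′ʲ` ↦ `tildIter L U₀ U′ j` ((1.20) = (69) of [3]); `Ū₁ʲ` (print p. 82, = [3]'s `U̿₁ʲ`) ↦ `dbavgCovIter L U₀ U₁ j` ((90)–(91));
`B_b` ↦ `Bint (Ũ′ʲ_b)` (interior), `Bcross L Ū₀^{j−1} Ũ′^{j−1} (L•b₋) (Ũ′ʲ_b)` (crossing, stated one level up `j ↦ j + 1` as in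
the parent), `BcrossMirror …` (the mirrored orientation print's «e.g.» leaves to the reader); (87) of [3] at a site ↦ the
parent's hypothesis shape `uLev L u j y = (wrec L U₀ U₁ j y)⁻¹` (delivered from the typed classes (1.19) `InAx` / (1.29)
`Restr129` by `B8Eq131Derivation.eq87_of_inAx_restr129`); (1.35) ↦ `‖(U′U₀)‾ʲ_b − Ū₀ʲ_b‖ ≤ α₁` on the certified averages
`avgIter`.

WHAT THIS MODULE PROVES (all statements kernel-checked, 0 sorry).
§1 [3] (127) READ BACKWARDS: `logCovIter_succ_eq_mlog` — if `U̿₁ʲ = exp Q_j` (the level-`j` identification, hypothesis `hId`)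
   then `Q_{j+1}(U₀, ηA)_b = log (U̿₁^{j+1})_b` at EVERY bond, with NO smallness (the definitions (121)/(127) and (91) agree
   term by term); `logCovIter_zero_eq_mlog` — level `0` (`Q₀ = ηA = log U₁`, needs `‖B₀_b‖ < ln 2`: `log ∘ exp = id`,
   `B7BlockAvgLog.mlog_exp`).
§2 (1.37) FIRST HALF, interior bonds: `Qj_eq_Bint` — `Q_{j+1}(U₀, ηA)_b = i·B_b`, `B_b = (1/i) log Ũ′^{j+1}_b`, from `hId` and (87)
   at `b₋`, `b₊` (the parent's `eq130_interior`: `Ũ′_b = (U̿₁)_b`); `Qj_eq_Bint_zero` — level `0`.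
§3 crossing bonds: `Qj_eq_Bcross` (printed orientation `b₋ ∈ Λ_j`, `b₊ ∈ Λ_{j+1}`; from `hId`, (87) on the block `B(b₋)` and at
   `b₊` — the parent's `eq131_crossing` at `V := (U′U₀)‾`, for which (1.13) is tautological) and `Qj_eq_BcrossMirror` (mirrored).
   All three identities are EXACT equalities in `𝔸`; the only analytic input is `hId`.
§4 (1.37) SECOND HALF transported to `Q_j` = the (1.42) clause «|Q_j(U₀, ηA)| < 2dLα₁» FROM (1.35): `norm_Qj_lt_interior`,
   `norm_Qj_lt_crossing`, `norm_Qj_lt_crossing_mirrored` (the parent's `eq137_*` / `B8Thm2LogB.ineq137_crossing_mirrored` bounds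
   `|B_b| < 2dLα₁` under `d, L ≥ 1`, `0 < α₁`, `dLα₁ ≤ 1/8`, `U1`-valued averages, + §2–§3).
§5 UNCONDITIONAL FORMS in [3] Prop. 4's regime (the hypotheses of `B7Eq123General.dbavgCovIter_eq_expCfg_logCovIter` verbatim:
   `U₀` valued in an averaging-closed `G ≤ U1`, `pdev U₀ < α₀L^{−2k}` = (1.40) at the level `k`, `C₀α₀ ≤ 1/3`, `4α₀ ≤ c₂′`,
   `sup‖B₀‖ ≤ b`, `e^{4cα₀}(1 + 8C₁Lᵏb) ≤ 2`, `2Lᵏb ≤ c₃`; `j ≤ k` for the identities, `j + 1 ≤ k` for the bounds): `Qj_eq_Bint_regular`, `Qj_eq_Bcross_regular`,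
   `Qj_eq_BcrossMirror_regular`, `Qj_eq_Bint_zero_regular`, `norm_Qj_lt_interior_regular`, `norm_Qj_lt_crossing_regular`.
§6 B8 CURRENCY `B₀ = iηA` under (1.41) «|A| < α₂(Lᵏη)⁻¹» (read globally, as in `B8Eq156Prop4.eq156_of_141`):
   `norm_Qj_lt_interior_of_141`, `norm_Qj_lt_crossing_of_141` — exactly the hypothesis `h42 : ‖logCovIter L U₀ (iEta η A) (j+1) z κ‖
   < 2dLα₁` of `B8Eq156Prop4.norm_B1_lt` / `wsup_B1_le` at the level `j + 1`, now DERIVED from (1.35) and Theorem 2's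
   construction instead of assumed; `norm_Qj_lt_interior_zero` (level `0`).
§7 p. 86 «hence LʲηQ_jA = B₁, … |B₁| < 2dLα₁ + C₂α₂²» WITH (1.42) DERIVED: `norm_B1_lt_of_135_interior`,
   `norm_B1_lt_of_135_crossing` = p40's `B8Eq156Prop4.norm_B1_lt` at the level `j + 1` fed by §6 (`k := j + 1`).
§8 (v1.1) «ON Λ_j» IN THE TYPED CLASSES (1.19) `B8Eq119TwistedAxial.InAx` / (1.29) `Restr129` (the (87)-hypotheses
   discharged by the parent's `eq87_of_inAx_restr129`; bond geometry = end-points in `Λ_{j+1}`, resp. print's «All sites of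
   the contours Γ_{b₋,x} belong to Λ_{j−1}» as `hblock`), in [3] Prop. 4's regime: `Qj_eq_Bint_of_inAx_restr129`,
   `Qj_eq_Bint_zero_of_inAx_restr129`, `Qj_eq_Bcross_of_inAx_restr129`, `Qj_eq_BcrossMirror_of_inAx_restr129`,
   `norm_Qj_lt_interior_of_inAx_restr129`, `norm_Qj_lt_crossing_of_inAx_restr129`.

HONEST SCOPE.  (i) `ℤᵈ` carriers of the lineage (every `d`, `L`, background `U₀`, complete normed algebra), not print's
`T_η`-subsets; the (87)-hypotheses and the bond geometry («`B(b₋) ⊂ Λ_{j}`», the block under `b₋`) enter exactly as in the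
parent `B8Eq131Derivation` (HONEST SCOPE (ii) there), not derived from (1.3)–(1.6).  (ii) The identification `hId` is [3]'s
(127); its unconditional form (§5) is p06's theorem in [3] Prop. 4's regime with that file's explicit constants — print's
«the representation of U₁ and the first condition on A in (1.36)» (p. 83) is precisely what makes `log ∘ exp = id` available
level by level; nothing is claimed outside that regime (in particular no `T_η`-periodicity, no region-wise (1.40) on `{Ω_j}`:
`pdev` is global on `ℤᵈ`, lineage convention).  (iii) No new bound: §4/§6 are the parent's (1.37) bounds moved across the
§2–§3 equalities.  (iv) Nothing here is progress on `Summit.QuantumFields`; the value is that the (1.37) line of Theorem 2 is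
now kernel-checked in all three parts on the lineage carriers and that a displayed hypothesis of the Sect. C bootstrap files
((1.42)'s `|B| < 2dLα₁` for `Q_j(U₀, ηA)`) is discharged from (1.35).

[cite: Balaban1985RegularSpaces, (1.37) p.82, (1.31) p.82, (1.42) p.83, p.83 («basically of an algebraic character»), (1.35) p.82;
Balaban1985Averaging, (127) p.37, p.38, (121) p.36, (90)–(92) p.31]
-/

noncomputable section

open NormedSpace Finset Complex

namespace Literature.MathematicalPhysics.QuantumFieldTheory.Balaban1983to89.B8Eq137QjEqB

open B7Prop1Explicit B7Prop2Explicit MatrixLog B7Eq92Concrete B7Eq99Concrete B7Eq84Concrete B7AvgGaugeCovariance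
open B7Prop3Flat (expCfg c3 c3_pos)
open B7Prop3GeneralLinear (Qcov)
open B7Prop4GeneralLevels (logCovIter linCovIter logCovIter_zero logCovIter_succ)
open B7Eq123General (dbavgCovIter_eq_expCfg_logCovIter level_data)
open B7BlockAvgLog (mlog_exp)
open B7Prop1Local (InBox)
open B8Lemma1NonAbelian (pert)
open B8Thm2LogB (blockTop Bint Bcross BcrossMirror)
open B8Eq131Derivation (eq130_interior eq131_crossing eq131_crossing_mirrored eq137_interior eq137_crossing
  pert_avgIter_eq_tildIter eq87_of_inAx_restr129)
open B8Eq119TwistedAxial (InAx Restr129)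
open B8Eq146AExpansion (iEta norm_iEta_le)

-- `Site` alone would resolve to the torus sites of `Setup.lean`; re-export the `ℤ^d` sites of `B7Prop1Explicit`.
export B7Prop1Explicit (Site)

variable {d : ℕ}
variable {𝔸 : Type*} [NormedRing 𝔸] [NormOneClass 𝔸] [NormedAlgebra ℂ 𝔸] [CompleteSpace 𝔸]

/-! ## §1 [3] (127) read backwards: `Q_{j+1}(U₀, ηA) = log U̿₁^{j+1}` once `U̿₁ʲ = exp Q_j(U₀, ηA)` -/

omit [NormOneClass 𝔸] in
/-- **[3] (127)/(121) vs (91), bondwise**: if the level-`j` identification `U̿₁ʲ = e^{Q_j(U₀, ηA)}` holds (`hId`, [3] (127);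
unconditional in Prop. 4's regime: `B7Eq123General.dbavgCovIter_eq_expCfg_logCovIter`), then at EVERY bond of the
`(j+1)`-lattice `Q_{j+1}(U₀, ηA)_b = log (U̿₁^{j+1})_b` — the one-step map (121) is `log` of the double-bar average of the
exponential, and (91) iterates the same average. No smallness. [cite: Balaban1985Averaging, (127) p.37, (121) p.36, (91) p.31] -/
theorem logCovIter_succ_eq_mlog (L : ℕ) (U₀ : Site d → Fin d → 𝔸ˣ) (B₀ : Site d → Fin d → 𝔸) (j : ℕ)
    (hId : dbavgCovIter L U₀ (expCfg B₀) j = expCfg (logCovIter L U₀ B₀ j)) (z : Site d) (κ : Fin d) :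
    logCovIter L U₀ B₀ (j + 1) z κ = mlog ((dbavgCovIter L U₀ (expCfg B₀) (j + 1) z κ : 𝔸ˣ) : 𝔸) := by
  rw [logCovIter_succ, Qcov, dbavgCovIter_succ, hId]

omit [NormOneClass 𝔸] in
/-- Level `0`: `Q₀(U₀, ηA)_b = ηA_b = (1/i) log U₁(b)` for `U₁ = e^{iηA}` with `|ηA_b| < ln 2` («the representation of U₁ and
the first condition on A in (1.36)», p. 83; `log ∘ exp = id` on the ball of radius `ln 2`, `B7BlockAvgLog.mlog_exp`).
[cite: Balaban1985RegularSpaces, p.83 («the representation of U₁»); Balaban1985Averaging, (127) p.37, (90) p.31] -/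
theorem logCovIter_zero_eq_mlog (L : ℕ) (U₀ : Site d → Fin d → 𝔸ˣ) (B₀ : Site d → Fin d → 𝔸) (z : Site d)
    (κ : Fin d) (h0 : ‖B₀ z κ‖ < Real.log 2) :
    logCovIter L U₀ B₀ 0 z κ = mlog ((dbavgCovIter L U₀ (expCfg B₀) 0 z κ : 𝔸ˣ) : 𝔸) := by
  simp only [logCovIter_zero, dbavgCovIter_zero, expCfg, val_expUnit]
  rw [mlog_exp h0]

/-! ## §2 (1.37), first half, on an interior bond `b ⊂ Λ_{j+1}`: `Q_{j+1}(U₀, ηA)_b = i·B_b`, `B_b = (1/i) log Ũ′^{j+1}_b` -/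

omit [NormOneClass 𝔸] in
/-- **(1.37) «Q_j(U₀, ηA) = B on Λ_j, B is given by formula (1.31) with V′ = Ũ′ʲ», INTERIOR bond** (stated at the level
`j + 1`): for `U₁ = e^{B₀}` (`B₀ = iηA`), (87) at `b₋`, `b₊` and the level-`j` identification `hId`,
`Q_{j+1}(U₀, ηA)_b = i·B_b` EXACTLY, `B_b = (1/i) log Ũ′^{j+1}_b` (`B8Thm2LogB.Bint`) — «it follows from the construction, as in
(1.30), (1.31)»: `Ũ′_b = (U̿₁)_b` (`B8Eq131Derivation.eq130_interior`, [3] (92)) and §1.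
[cite: Balaban1985RegularSpaces, (1.37) p.82, (1.31) p.82, p.83; Balaban1985Averaging, (127) p.37, (92) p.31] -/
theorem Qj_eq_Bint (L : ℕ) (U₀ : Site d → Fin d → 𝔸ˣ) (B₀ : Site d → Fin d → 𝔸) (u : Site d → 𝔸ˣ) (j : ℕ)
    (hId : dbavgCovIter L U₀ (expCfg B₀) j = expCfg (logCovIter L U₀ B₀ j)) (y : Site d) (κ : Fin d)
    (hm : uLev L u (j + 1) y = (wrec L U₀ (expCfg B₀) (j + 1) y)⁻¹)
    (hp : uLev L u (j + 1) (y + e κ) = (wrec L U₀ (expCfg B₀) (j + 1) (y + e κ))⁻¹) :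
    logCovIter L U₀ B₀ (j + 1) y κ = I • Bint (tildIter L U₀ (mgauge U₀ u (expCfg B₀)) (j + 1) y κ) := by
  rw [logCovIter_succ_eq_mlog L U₀ B₀ j hId, ← eq130_interior L U₀ (expCfg B₀) u (j + 1) y κ hm hp, Bint, smul_smul,
    mul_inv_cancel₀ I_ne_zero, one_smul]

omit [NormOneClass 𝔸] in
/-- **(1.37), interior bond, level `0`** (`Λ₀`): `Q₀(U₀, ηA)_b = ηA_b = i·B_b`, `B_b = (1/i) log Ũ′⁰_b = (1/i) log U′_b`, from
(87) at level `0` (= (1.14) `u = 1`) at `b₋`, `b₊` and `|ηA_b| < ln 2`. [cite: Balaban1985RegularSpaces, (1.37) p.82, (1.14) p.78, p.83] -/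
theorem Qj_eq_Bint_zero (L : ℕ) (U₀ : Site d → Fin d → 𝔸ˣ) (B₀ : Site d → Fin d → 𝔸) (u : Site d → 𝔸ˣ)
    (y : Site d) (κ : Fin d) (h0 : ‖B₀ y κ‖ < Real.log 2)
    (hm : uLev L u 0 y = (wrec L U₀ (expCfg B₀) 0 y)⁻¹)
    (hp : uLev L u 0 (y + e κ) = (wrec L U₀ (expCfg B₀) 0 (y + e κ))⁻¹) :
    logCovIter L U₀ B₀ 0 y κ = I • Bint (tildIter L U₀ (mgauge U₀ u (expCfg B₀)) 0 y κ) := by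
  rw [logCovIter_zero_eq_mlog L U₀ B₀ y κ h0, ← eq130_interior L U₀ (expCfg B₀) u 0 y κ hm hp, Bint, smul_smul,
    mul_inv_cancel₀ I_ne_zero, one_smul]

/-! ## §3 (1.37), first half, on the crossing bonds (stated one level up, as in the parent) -/

omit [NormOneClass 𝔸] in
/-- **(1.37), CROSSING bond** `b₋ ∈ Λ_j`, `b₊ ∈ Λ_{j+1}` (printed orientation): for `U₁ = e^{B₀}`, (87) at the sites of the
block `B(b₋)` and at `b₊`, and `hId` at the level `j`: `Q_{j+1}(U₀, ηA)_b = i·B_b` EXACTLY with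
`B_b = (1/i) log(exp[−i Σ_{x∈B(b₋)} L^{−d} (1/i) log(R̄ʲ_{0,b₋}Ũ′ʲ)(Γ_{b₋,x})] Ũ′^{j+1}_b)` (`B8Thm2LogB.Bcross` with `V′ = Ũ′`)
— the parent's `eq131_crossing` at `V := (U′U₀)‾` ((1.13) tautological) and §1.
[cite: Balaban1985RegularSpaces, (1.37) p.82, (1.31) p.82; Balaban1985Averaging, (127) p.37, (92) p.31, (97) p.32, (99) p.32, (105) p.33] -/
theorem Qj_eq_Bcross (L : ℕ) (hL : 1 ≤ L) (U₀ : Site d → Fin d → 𝔸ˣ) (B₀ : Site d → Fin d → 𝔸) (u : Site d → 𝔸ˣ)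
    (j : ℕ) (hId : dbavgCovIter L U₀ (expCfg B₀) j = expCfg (logCovIter L U₀ B₀ j)) (y : Site d) (κ : Fin d)
    (h87 : ∀ x : Site d, InBox ((L : ℤ) • y) ((L : ℤ) • y + blockTop L) x →
      uLev L u j x = (wrec L U₀ (expCfg B₀) j x)⁻¹)
    (hp : uLev L u (j + 1) (y + e κ) = (wrec L U₀ (expCfg B₀) (j + 1) (y + e κ))⁻¹) :
    logCovIter L U₀ B₀ (j + 1) y κ
      = I • Bcross L (avgIter L U₀ j) (tildIter L U₀ (mgauge U₀ u (expCfg B₀)) j) ((L : ℤ) • y)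
          (tildIter L U₀ (mgauge U₀ u (expCfg B₀)) (j + 1) y κ) := by
  have hid := eq131_crossing L hL U₀ (expCfg B₀) u j y κ (avgIter L (mgauge U₀ u (expCfg B₀) * U₀) j)
    (avgIter L (mgauge U₀ u (expCfg B₀) * U₀) (j + 1)) h87 (fun _ _ _ _ => rfl) hp rfl
  rw [pert_avgIter_eq_tildIter] at hid
  rw [tildIter_apply L U₀ _ (j + 1) y κ, logCovIter_succ_eq_mlog L U₀ B₀ j hId, hid, Bcross, smul_smul,
    mul_inv_cancel₀ I_ne_zero, one_smul]

omit [NormOneClass 𝔸] in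
/-- **(1.37), MIRRORED crossing bond** `b₋ ∈ Λ_{j+1}`, `b₊ ∈ Λ_j` (print's «e.g.»): for `U₁ = e^{B₀}`, (87) at `b₋` (level
`j + 1`) and on the block `B(b₊)`, and `hId`: `Q_{j+1}(U₀, ηA)_b = i·B_b` EXACTLY with `B_b = B8Thm2LogB.BcrossMirror …`
(`(1/i) log(Ũ′_b · R(Ū₀(b)) exp[+i Σ_{B(b₊)} …])`) — the parent's `eq131_crossing_mirrored` and §1.
[cite: Balaban1985RegularSpaces, (1.37) p.82, (1.31) p.82; Balaban1985Averaging, (127) p.37, (92) p.31] -/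
theorem Qj_eq_BcrossMirror (L : ℕ) (hL : 1 ≤ L) (U₀ : Site d → Fin d → 𝔸ˣ) (B₀ : Site d → Fin d → 𝔸)
    (u : Site d → 𝔸ˣ) (j : ℕ) (hId : dbavgCovIter L U₀ (expCfg B₀) j = expCfg (logCovIter L U₀ B₀ j)) (y : Site d)
    (κ : Fin d) (hm : uLev L u (j + 1) y = (wrec L U₀ (expCfg B₀) (j + 1) y)⁻¹)
    (h87 : ∀ x : Site d, InBox ((L : ℤ) • (y + e κ)) ((L : ℤ) • (y + e κ) + blockTop L) x →
      uLev L u j x = (wrec L U₀ (expCfg B₀) j x)⁻¹) :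
    logCovIter L U₀ B₀ (j + 1) y κ
      = I • BcrossMirror L (avgIter L U₀ j) (tildIter L U₀ (mgauge U₀ u (expCfg B₀)) j) ((L : ℤ) • (y + e κ))
          (avgIter L U₀ (j + 1) y κ) (tildIter L U₀ (mgauge U₀ u (expCfg B₀)) (j + 1) y κ) := by
  have hid := eq131_crossing_mirrored L hL U₀ (expCfg B₀) u j y κ (avgIter L (mgauge U₀ u (expCfg B₀) * U₀) j)
    (avgIter L (mgauge U₀ u (expCfg B₀) * U₀) (j + 1)) hm h87 (fun _ _ _ _ => rfl) rfl
  rw [pert_avgIter_eq_tildIter] at hid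
  rw [tildIter_apply L U₀ _ (j + 1) y κ, logCovIter_succ_eq_mlog L U₀ B₀ j hId, hid, BcrossMirror, smul_smul,
    mul_inv_cancel₀ I_ne_zero, one_smul]

/-! ## §4 (1.37), second half, for `Q_j` = the (1.42) clause «|Q_j(U₀, ηA)| < 2dLα₁» from (1.35) -/

/-- **«|B| < 2dLα₁ by the assumption (1.35)» for `Q_{j+1}(U₀, ηA)`, interior bond**: under §2's hypotheses, `Ū₀^{j+1}_b ∈ U1`
and (1.35) `|(U′U₀)‾^{j+1}_b − Ū₀^{j+1}_b| ≤ α₁` (`d, L ≥ 1`, `0 < α₁`, `dLα₁ ≤ 1/8`): `‖Q_{j+1}(U₀, ηA)_b‖ < 2dLα₁` — the parent's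
`eq137_interior` bound moved across `Qj_eq_Bint`; this is (1.42)'s second clause for the constructed configuration.
[cite: Balaban1985RegularSpaces, (1.37) p.82, (1.42) p.83, (1.35) p.82] -/
theorem norm_Qj_lt_interior (L : ℕ) (hd : 1 ≤ d) (hL : 1 ≤ L) (U₀ : Site d → Fin d → 𝔸ˣ)
    (B₀ : Site d → Fin d → 𝔸) (u : Site d → 𝔸ˣ) (j : ℕ)
    (hId : dbavgCovIter L U₀ (expCfg B₀) j = expCfg (logCovIter L U₀ B₀ j)) (y : Site d) (κ : Fin d)
    (hm : uLev L u (j + 1) y = (wrec L U₀ (expCfg B₀) (j + 1) y)⁻¹)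
    (hp : uLev L u (j + 1) (y + e κ) = (wrec L U₀ (expCfg B₀) (j + 1) (y + e κ))⁻¹)
    (h₀ : avgIter L U₀ (j + 1) y κ ∈ U1 𝔸) {α₁ : ℝ} (hα : 0 < α₁) (hsmall : (d : ℝ) * L * α₁ ≤ 1 / 8)
    (h135 : ‖(avgIter L (mgauge U₀ u (expCfg B₀) * U₀) (j + 1) y κ : 𝔸) - (avgIter L U₀ (j + 1) y κ : 𝔸)‖ ≤ α₁) :
    ‖logCovIter L U₀ B₀ (j + 1) y κ‖ < 2 * d * L * α₁ := by
  rw [Qj_eq_Bint L U₀ B₀ u j hId y κ hm hp, norm_smul, Complex.norm_I, one_mul]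
  exact (eq137_interior L hd hL U₀ (expCfg B₀) u (j + 1) y κ hm hp h₀ hα hsmall h135).2

/-- **Level `0`** (`Λ₀`, where (87) reads `u = 1`, (1.14)): `‖Q₀(U₀, ηA)_b‖ = |ηA_b| < 2dLα₁` from (1.35) at the bond and
`|ηA_b| < ln 2`. [cite: Balaban1985RegularSpaces, (1.37) p.82, (1.42) p.83, (1.35) p.82, (1.14) p.78] -/
theorem norm_Qj_lt_interior_zero (L : ℕ) (hd : 1 ≤ d) (hL : 1 ≤ L) (U₀ : Site d → Fin d → 𝔸ˣ)
    (B₀ : Site d → Fin d → 𝔸) (u : Site d → 𝔸ˣ) (y : Site d) (κ : Fin d) (h0 : ‖B₀ y κ‖ < Real.log 2)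
    (hm : uLev L u 0 y = (wrec L U₀ (expCfg B₀) 0 y)⁻¹)
    (hp : uLev L u 0 (y + e κ) = (wrec L U₀ (expCfg B₀) 0 (y + e κ))⁻¹)
    (h₀ : avgIter L U₀ 0 y κ ∈ U1 𝔸) {α₁ : ℝ} (hα : 0 < α₁) (hsmall : (d : ℝ) * L * α₁ ≤ 1 / 8)
    (h135 : ‖(avgIter L (mgauge U₀ u (expCfg B₀) * U₀) 0 y κ : 𝔸) - (avgIter L U₀ 0 y κ : 𝔸)‖ ≤ α₁) :
    ‖logCovIter L U₀ B₀ 0 y κ‖ < 2 * d * L * α₁ := by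
  rw [Qj_eq_Bint_zero L U₀ B₀ u y κ h0 hm hp, norm_smul, Complex.norm_I, one_mul]
  exact (eq137_interior L hd hL U₀ (expCfg B₀) u 0 y κ hm hp h₀ hα hsmall h135).2

/-- **The same on a crossing bond** `b₋ ∈ Λ_j`, `b₊ ∈ Λ_{j+1}`: under §3's hypotheses and the data of the parent's
`eq137_crossing` (`U1`-valued averages, (1.35) on the bonds of the block `B(b₋)` and at `b`): `‖Q_{j+1}(U₀, ηA)_b‖ < 2dLα₁`.
[cite: Balaban1985RegularSpaces, (1.37) p.82, (1.42) p.83, (1.35) p.82] -/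
theorem norm_Qj_lt_crossing (L : ℕ) (hd : 1 ≤ d) (hL : 1 ≤ L) (U₀ : Site d → Fin d → 𝔸ˣ)
    (B₀ : Site d → Fin d → 𝔸) (u : Site d → 𝔸ˣ) (j : ℕ)
    (hId : dbavgCovIter L U₀ (expCfg B₀) j = expCfg (logCovIter L U₀ B₀ j)) (y : Site d) (κ : Fin d)
    (h87 : ∀ x : Site d, InBox ((L : ℤ) • y) ((L : ℤ) • y + blockTop L) x →
      uLev L u j x = (wrec L U₀ (expCfg B₀) j x)⁻¹)
    (hp : uLev L u (j + 1) (y + e κ) = (wrec L U₀ (expCfg B₀) (j + 1) (y + e κ))⁻¹)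
    (hU : ∀ x μ, avgIter L (mgauge U₀ u (expCfg B₀) * U₀) j x μ ∈ U1 𝔸) (hV₀ : ∀ x μ, avgIter L U₀ j x μ ∈ U1 𝔸)
    (hW : avgIter L (mgauge U₀ u (expCfg B₀) * U₀) (j + 1) y κ ∈ U1 𝔸) (hW₀ : avgIter L U₀ (j + 1) y κ ∈ U1 𝔸)
    {α₁ : ℝ} (hα : 0 < α₁) (hsmall : (d : ℝ) * L * α₁ ≤ 1 / 8)
    (h135 : ∀ (z : Site d) (μ : Fin d), (L : ℤ) • y ≤ z → z + e μ ≤ (L : ℤ) • y + blockTop L →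
      ‖(avgIter L (mgauge U₀ u (expCfg B₀) * U₀) j z μ : 𝔸) - (avgIter L U₀ j z μ : 𝔸)‖ ≤ α₁)
    (h135b : ‖(avgIter L (mgauge U₀ u (expCfg B₀) * U₀) (j + 1) y κ : 𝔸) - (avgIter L U₀ (j + 1) y κ : 𝔸)‖ ≤ α₁) :
    ‖logCovIter L U₀ B₀ (j + 1) y κ‖ < 2 * d * L * α₁ := by
  rw [Qj_eq_Bcross L hL U₀ B₀ u j hId y κ h87 hp, norm_smul, Complex.norm_I, one_mul]
  exact (eq137_crossing L hd hL U₀ (expCfg B₀) u j y κ h87 hp hU hV₀ hW hW₀ hα hsmall h135 h135b).2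

/-- **The same on a mirrored crossing bond** `b₋ ∈ Λ_{j+1}`, `b₊ ∈ Λ_j`: (87) at `b₋` and on the block `B(b₊)`, `U1`-valued
averages, (1.35) on the bonds of `B(b₊)` (level `j`) and at `b` (level `j + 1`): `‖Q_{j+1}(U₀, ηA)_b‖ < 2dLα₁`
(`B8Thm2LogB.ineq137_crossing_mirrored` moved across `Qj_eq_BcrossMirror`). [cite: Balaban1985RegularSpaces, (1.37) p.82, (1.42) p.83, (1.35) p.82] -/
theorem norm_Qj_lt_crossing_mirrored (L : ℕ) (hd : 1 ≤ d) (hL : 1 ≤ L) (U₀ : Site d → Fin d → 𝔸ˣ)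
    (B₀ : Site d → Fin d → 𝔸) (u : Site d → 𝔸ˣ) (j : ℕ)
    (hId : dbavgCovIter L U₀ (expCfg B₀) j = expCfg (logCovIter L U₀ B₀ j)) (y : Site d) (κ : Fin d)
    (hm : uLev L u (j + 1) y = (wrec L U₀ (expCfg B₀) (j + 1) y)⁻¹)
    (h87 : ∀ x : Site d, InBox ((L : ℤ) • (y + e κ)) ((L : ℤ) • (y + e κ) + blockTop L) x →
      uLev L u j x = (wrec L U₀ (expCfg B₀) j x)⁻¹)
    (hU : ∀ x μ, avgIter L (mgauge U₀ u (expCfg B₀) * U₀) j x μ ∈ U1 𝔸) (hV₀ : ∀ x μ, avgIter L U₀ j x μ ∈ U1 𝔸)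
    (hW : avgIter L (mgauge U₀ u (expCfg B₀) * U₀) (j + 1) y κ ∈ U1 𝔸) (hW₀ : avgIter L U₀ (j + 1) y κ ∈ U1 𝔸)
    {α₁ : ℝ} (hα : 0 < α₁) (hsmall : (d : ℝ) * L * α₁ ≤ 1 / 8)
    (h135 : ∀ (z : Site d) (μ : Fin d), (L : ℤ) • (y + e κ) ≤ z → z + e μ ≤ (L : ℤ) • (y + e κ) + blockTop L →
      ‖(avgIter L (mgauge U₀ u (expCfg B₀) * U₀) j z μ : 𝔸) - (avgIter L U₀ j z μ : 𝔸)‖ ≤ α₁)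
    (h135b : ‖(avgIter L (mgauge U₀ u (expCfg B₀) * U₀) (j + 1) y κ : 𝔸) - (avgIter L U₀ (j + 1) y κ : 𝔸)‖ ≤ α₁) :
    ‖logCovIter L U₀ B₀ (j + 1) y κ‖ < 2 * d * L * α₁ := by
  rw [Qj_eq_BcrossMirror L hL U₀ B₀ u j hId y κ hm h87, norm_smul, Complex.norm_I, one_mul]
  have hw1 : avgIter L (mgauge U₀ u (expCfg B₀) * U₀) (j + 1) y κ * (avgIter L U₀ (j + 1) y κ)⁻¹ ∈ U1 𝔸 :=
    (U1 𝔸).mul_mem hW ((U1 𝔸).inv_mem hW₀)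
  have hw : ‖((avgIter L (mgauge U₀ u (expCfg B₀) * U₀) (j + 1) y κ * (avgIter L U₀ (j + 1) y κ)⁻¹ : 𝔸ˣ) : 𝔸) - 1‖
      ≤ α₁ :=
    (B8Thm2LogB.norm_mul_inv_sub_one_le _ hW₀).trans h135b
  have hs : B8Thm2LogB.BondSmall (pert (avgIter L (mgauge U₀ u (expCfg B₀) * U₀) j) (avgIter L U₀ j))
      ((L : ℤ) • (y + e κ)) ((L : ℤ) • (y + e κ) + blockTop L) α₁ := fun z μ hz hzμ =>
    (B8Thm2LogB.norm_pert_sub_one_le _ _ z μ (hV₀ z μ)).trans (h135 z μ hz hzμ)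
  have h := B8Thm2LogB.ineq137_crossing_mirrored L hd hL hα hsmall (avgIter L U₀ j) _ hV₀
    (B8Thm2LogB.pert_mem hU hV₀) ((L : ℤ) • (y + e κ)) hs hW₀ hw1 hw
  rw [pert_avgIter_eq_tildIter] at h
  rwa [tildIter_apply L U₀ _ (j + 1) y κ]

/-! ## §5 Unconditional forms in [3] Prop. 4's regime (the identification `hId` discharged by `B7Eq123General`) -/

omit [NormOneClass 𝔸] [NormedAlgebra ℂ 𝔸] [CompleteSpace 𝔸] in
/-- In the regime `2Lᵏb ≤ c₃(d, L) = 1/(128(d+1)L)` the exponent field is inside the ball of radius `ln 2` where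
`log ∘ exp = id`: `sup‖B₀‖ ≤ b < ln 2`. [cite: Balaban1985Averaging, Prop. 3 p.36 («c₃ depends on d and L»), (21) p.21] -/
theorem lt_log_two_of_regime {L : ℕ} (hL : 1 ≤ L) {k : ℕ} {b : ℝ} (hc₃ : 2 * ((L : ℝ) ^ k * b) ≤ c3 d L)
    {B₀ : Site d → Fin d → 𝔸} (hB : ∀ x κ, ‖B₀ x κ‖ ≤ b) (z : Site d) (κ : Fin d) : ‖B₀ z κ‖ < Real.log 2 := by
  have hL1 : (1 : ℝ) ≤ (L : ℝ) ^ k := one_le_pow₀ (by exact_mod_cast hL)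
  have hc : c3 d L ≤ 1 / 128 := by
    unfold c3
    have hL' : (1 : ℝ) ≤ L := by exact_mod_cast hL
    have hd0 : (0 : ℝ) ≤ d := by positivity
    rw [div_le_div_iff₀ (by positivity) (by norm_num)]
    nlinarith
  have hlog := Real.log_two_gt_d9
  have hb : b ≤ (L : ℝ) ^ k * b := by
    rcases le_or_gt 0 b with hb0 | hb0
    · exact le_mul_of_one_le_left hb0 hL1
    · exact absurd ((norm_nonneg _).trans (hB z κ)) (not_le.mpr hb0)
  exact (hB z κ).trans_lt (by linarith)

/-- **(1.37) first half, interior bond, UNCONDITIONAL in [3] Prop. 4's regime** (the hypotheses of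
`B7Eq123General.dbavgCovIter_eq_expCfg_logCovIter` verbatim — `U₀` valued in an averaging-closed `G ≤ U1`, (1.40)
`pdev U₀ < α₀L^{−2k}`, `sup‖B₀‖ ≤ b`, the explicit smallness of p06's file — and `j ≤ k`): `Q_{j+1}(U₀, ηA)_b = i·B_b`.
[cite: Balaban1985RegularSpaces, (1.37) p.82, (1.40)–(1.41) p.83; Balaban1985Averaging, (127) p.37, Prop. 4 p.38] -/
theorem Qj_eq_Bint_regular (L : ℕ) (hL : 2 ≤ L) {G : Subgroup 𝔸ˣ} (hG : AvgClosed d L G) (k : ℕ)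
    (U₀ : Site d → Fin d → 𝔸ˣ) (hU₀ : ∀ x κ, U₀ x κ ∈ G) {α₀ : ℝ} (hα₀ : 0 < α₀)
    (hα3 : C0 d * α₀ ≤ 1 / 3) (hα4 : 4 * α₀ ≤ c2' d L) (h40 : pdev U₀ < α₀ * (((L : ℝ) ^ k)⁻¹) ^ 2)
    (B₀ : Site d → Fin d → 𝔸) {b : ℝ} (hb : 0 ≤ b) (hB : ∀ x κ, ‖B₀ x κ‖ ≤ b)
    (hsm : Real.exp (4 * (800 * ((d : ℝ) + 1) ^ 2 * ((d : ℝ) + 4)) * α₀)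
      * (1 + 8 * (131072 * ((d : ℝ) + 1) ^ 2) * ((L : ℝ) ^ k * b)) ≤ 2)
    (hc₃ : 2 * ((L : ℝ) ^ k * b) ≤ c3 d L) (u : Site d → 𝔸ˣ) {j : ℕ} (hjk : j ≤ k) (y : Site d) (κ : Fin d)
    (hm : uLev L u (j + 1) y = (wrec L U₀ (expCfg B₀) (j + 1) y)⁻¹)
    (hp : uLev L u (j + 1) (y + e κ) = (wrec L U₀ (expCfg B₀) (j + 1) (y + e κ))⁻¹) :
    logCovIter L U₀ B₀ (j + 1) y κ = I • Bint (tildIter L U₀ (mgauge U₀ u (expCfg B₀)) (j + 1) y κ) :=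
  Qj_eq_Bint L U₀ B₀ u j
    (dbavgCovIter_eq_expCfg_logCovIter L hL hG k U₀ hU₀ hα₀ hα3 hα4 h40 B₀ hb hB hsm hc₃ j hjk) y κ hm hp

omit [NormOneClass 𝔸] in
/-- Level `0` in the same regime (`sup‖B₀‖ ≤ b < ln 2` by `lt_log_two_of_regime`): `Q₀(U₀, ηA)_b = i·B_b`.
[cite: Balaban1985RegularSpaces, (1.37) p.82, (1.14) p.78; Balaban1985Averaging, (127) p.37] -/
theorem Qj_eq_Bint_zero_regular (L : ℕ) (hL : 1 ≤ L) (k : ℕ) (U₀ : Site d → Fin d → 𝔸ˣ)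
    (B₀ : Site d → Fin d → 𝔸) {b : ℝ} (hB : ∀ x κ, ‖B₀ x κ‖ ≤ b) (hc₃ : 2 * ((L : ℝ) ^ k * b) ≤ c3 d L)
    (u : Site d → 𝔸ˣ) (y : Site d) (κ : Fin d) (hm : uLev L u 0 y = (wrec L U₀ (expCfg B₀) 0 y)⁻¹)
    (hp : uLev L u 0 (y + e κ) = (wrec L U₀ (expCfg B₀) 0 (y + e κ))⁻¹) :
    logCovIter L U₀ B₀ 0 y κ = I • Bint (tildIter L U₀ (mgauge U₀ u (expCfg B₀)) 0 y κ) :=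
  Qj_eq_Bint_zero L U₀ B₀ u y κ (lt_log_two_of_regime hL hc₃ hB y κ) hm hp

/-- **(1.37) first half, crossing bond, UNCONDITIONAL in [3] Prop. 4's regime.**
[cite: Balaban1985RegularSpaces, (1.37) p.82, (1.31) p.82; Balaban1985Averaging, (127) p.37, Prop. 4 p.38] -/
theorem Qj_eq_Bcross_regular (L : ℕ) (hL : 2 ≤ L) {G : Subgroup 𝔸ˣ} (hG : AvgClosed d L G) (k : ℕ)
    (U₀ : Site d → Fin d → 𝔸ˣ) (hU₀ : ∀ x κ, U₀ x κ ∈ G) {α₀ : ℝ} (hα₀ : 0 < α₀)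
    (hα3 : C0 d * α₀ ≤ 1 / 3) (hα4 : 4 * α₀ ≤ c2' d L) (h40 : pdev U₀ < α₀ * (((L : ℝ) ^ k)⁻¹) ^ 2)
    (B₀ : Site d → Fin d → 𝔸) {b : ℝ} (hb : 0 ≤ b) (hB : ∀ x κ, ‖B₀ x κ‖ ≤ b)
    (hsm : Real.exp (4 * (800 * ((d : ℝ) + 1) ^ 2 * ((d : ℝ) + 4)) * α₀)
      * (1 + 8 * (131072 * ((d : ℝ) + 1) ^ 2) * ((L : ℝ) ^ k * b)) ≤ 2)
    (hc₃ : 2 * ((L : ℝ) ^ k * b) ≤ c3 d L) (u : Site d → 𝔸ˣ) {j : ℕ} (hjk : j ≤ k) (y : Site d) (κ : Fin d)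
    (h87 : ∀ x : Site d, InBox ((L : ℤ) • y) ((L : ℤ) • y + blockTop L) x →
      uLev L u j x = (wrec L U₀ (expCfg B₀) j x)⁻¹)
    (hp : uLev L u (j + 1) (y + e κ) = (wrec L U₀ (expCfg B₀) (j + 1) (y + e κ))⁻¹) :
    logCovIter L U₀ B₀ (j + 1) y κ
      = I • Bcross L (avgIter L U₀ j) (tildIter L U₀ (mgauge U₀ u (expCfg B₀)) j) ((L : ℤ) • y)
          (tildIter L U₀ (mgauge U₀ u (expCfg B₀)) (j + 1) y κ) :=
  Qj_eq_Bcross L (le_trans (by norm_num) hL) U₀ B₀ u j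
    (dbavgCovIter_eq_expCfg_logCovIter L hL hG k U₀ hU₀ hα₀ hα3 hα4 h40 B₀ hb hB hsm hc₃ j hjk) y κ h87 hp

/-- **(1.37) first half, mirrored crossing bond, UNCONDITIONAL in [3] Prop. 4's regime.**
[cite: Balaban1985RegularSpaces, (1.37) p.82, (1.31) p.82; Balaban1985Averaging, (127) p.37, Prop. 4 p.38] -/
theorem Qj_eq_BcrossMirror_regular (L : ℕ) (hL : 2 ≤ L) {G : Subgroup 𝔸ˣ} (hG : AvgClosed d L G) (k : ℕ)
    (U₀ : Site d → Fin d → 𝔸ˣ) (hU₀ : ∀ x κ, U₀ x κ ∈ G) {α₀ : ℝ} (hα₀ : 0 < α₀)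
    (hα3 : C0 d * α₀ ≤ 1 / 3) (hα4 : 4 * α₀ ≤ c2' d L) (h40 : pdev U₀ < α₀ * (((L : ℝ) ^ k)⁻¹) ^ 2)
    (B₀ : Site d → Fin d → 𝔸) {b : ℝ} (hb : 0 ≤ b) (hB : ∀ x κ, ‖B₀ x κ‖ ≤ b)
    (hsm : Real.exp (4 * (800 * ((d : ℝ) + 1) ^ 2 * ((d : ℝ) + 4)) * α₀)
      * (1 + 8 * (131072 * ((d : ℝ) + 1) ^ 2) * ((L : ℝ) ^ k * b)) ≤ 2)
    (hc₃ : 2 * ((L : ℝ) ^ k * b) ≤ c3 d L) (u : Site d → 𝔸ˣ) {j : ℕ} (hjk : j ≤ k) (y : Site d) (κ : Fin d)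
    (hm : uLev L u (j + 1) y = (wrec L U₀ (expCfg B₀) (j + 1) y)⁻¹)
    (h87 : ∀ x : Site d, InBox ((L : ℤ) • (y + e κ)) ((L : ℤ) • (y + e κ) + blockTop L) x →
      uLev L u j x = (wrec L U₀ (expCfg B₀) j x)⁻¹) :
    logCovIter L U₀ B₀ (j + 1) y κ
      = I • BcrossMirror L (avgIter L U₀ j) (tildIter L U₀ (mgauge U₀ u (expCfg B₀)) j) ((L : ℤ) • (y + e κ))
          (avgIter L U₀ (j + 1) y κ) (tildIter L U₀ (mgauge U₀ u (expCfg B₀)) (j + 1) y κ) :=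
  Qj_eq_BcrossMirror L (le_trans (by norm_num) hL) U₀ B₀ u j
    (dbavgCovIter_eq_expCfg_logCovIter L hL hG k U₀ hU₀ hα₀ hα3 hα4 h40 B₀ hb hB hsm hc₃ j hjk) y κ hm h87

/-- **(1.42) clause «|Q_j(U₀, ηA)| < 2dLα₁» from (1.35), interior bond, UNCONDITIONAL in [3] Prop. 4's regime** (`d ≥ 1`,
`L ≥ 2`, `0 < α₁`, `dLα₁ ≤ 1/8`; the `U1`-membership of `Ū₀^{j+1}_b` follows from `U₀ ∈ G`, `G` averaging-closed).
[cite: Balaban1985RegularSpaces, (1.42) p.83, (1.37) p.82, (1.35) p.82] -/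
theorem norm_Qj_lt_interior_regular (L : ℕ) (hd : 1 ≤ d) (hL : 2 ≤ L) {G : Subgroup 𝔸ˣ} (hG : AvgClosed d L G)
    (k : ℕ) (U₀ : Site d → Fin d → 𝔸ˣ) (hU₀ : ∀ x κ, U₀ x κ ∈ G) {α₀ : ℝ} (hα₀ : 0 < α₀)
    (hα3 : C0 d * α₀ ≤ 1 / 3) (hα4 : 4 * α₀ ≤ c2' d L) (h40 : pdev U₀ < α₀ * (((L : ℝ) ^ k)⁻¹) ^ 2)
    (B₀ : Site d → Fin d → 𝔸) {b : ℝ} (hb : 0 ≤ b) (hB : ∀ x κ, ‖B₀ x κ‖ ≤ b)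
    (hsm : Real.exp (4 * (800 * ((d : ℝ) + 1) ^ 2 * ((d : ℝ) + 4)) * α₀)
      * (1 + 8 * (131072 * ((d : ℝ) + 1) ^ 2) * ((L : ℝ) ^ k * b)) ≤ 2)
    (hc₃ : 2 * ((L : ℝ) ^ k * b) ≤ c3 d L) (u : Site d → 𝔸ˣ) {j : ℕ} (hjk : j + 1 ≤ k) (y : Site d) (κ : Fin d)
    (hm : uLev L u (j + 1) y = (wrec L U₀ (expCfg B₀) (j + 1) y)⁻¹)
    (hp : uLev L u (j + 1) (y + e κ) = (wrec L U₀ (expCfg B₀) (j + 1) (y + e κ))⁻¹)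
    {α₁ : ℝ} (hα : 0 < α₁) (hsmall : (d : ℝ) * L * α₁ ≤ 1 / 8)
    (h135 : ‖(avgIter L (mgauge U₀ u (expCfg B₀) * U₀) (j + 1) y κ : 𝔸) - (avgIter L U₀ (j + 1) y κ : 𝔸)‖ ≤ α₁) :
    ‖logCovIter L U₀ B₀ (j + 1) y κ‖ < 2 * d * L * α₁ :=
  norm_Qj_lt_interior L hd (le_trans (by norm_num) hL) U₀ B₀ u j
    (dbavgCovIter_eq_expCfg_logCovIter L hL hG k U₀ hU₀ hα₀ hα3 hα4 h40 B₀ hb hB hsm hc₃ j (Nat.le_of_succ_le hjk))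
    y κ hm hp ((level_data L hL hG k U₀ hU₀ hα₀ hα3 hα4 h40 (j + 1) hjk).1 y κ) hα hsmall h135

/-- **(1.42) clause from (1.35), crossing bond, UNCONDITIONAL in [3] Prop. 4's regime** (the `U1`-memberships of the averages
of `U₀` follow from `U₀ ∈ G`; those of `(U′U₀)‾` are kept as hypotheses — they are print's `U′U₀ ∈ 𝔄_k` side, [3] Prop. 2).
[cite: Balaban1985RegularSpaces, (1.42) p.83, (1.37) p.82, (1.35) p.82] -/
theorem norm_Qj_lt_crossing_regular (L : ℕ) (hd : 1 ≤ d) (hL : 2 ≤ L) {G : Subgroup 𝔸ˣ} (hG : AvgClosed d L G)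
    (k : ℕ) (U₀ : Site d → Fin d → 𝔸ˣ) (hU₀ : ∀ x κ, U₀ x κ ∈ G) {α₀ : ℝ} (hα₀ : 0 < α₀)
    (hα3 : C0 d * α₀ ≤ 1 / 3) (hα4 : 4 * α₀ ≤ c2' d L) (h40 : pdev U₀ < α₀ * (((L : ℝ) ^ k)⁻¹) ^ 2)
    (B₀ : Site d → Fin d → 𝔸) {b : ℝ} (hb : 0 ≤ b) (hB : ∀ x κ, ‖B₀ x κ‖ ≤ b)
    (hsm : Real.exp (4 * (800 * ((d : ℝ) + 1) ^ 2 * ((d : ℝ) + 4)) * α₀)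
      * (1 + 8 * (131072 * ((d : ℝ) + 1) ^ 2) * ((L : ℝ) ^ k * b)) ≤ 2)
    (hc₃ : 2 * ((L : ℝ) ^ k * b) ≤ c3 d L) (u : Site d → 𝔸ˣ) {j : ℕ} (hjk : j + 1 ≤ k) (y : Site d) (κ : Fin d)
    (h87 : ∀ x : Site d, InBox ((L : ℤ) • y) ((L : ℤ) • y + blockTop L) x →
      uLev L u j x = (wrec L U₀ (expCfg B₀) j x)⁻¹)
    (hp : uLev L u (j + 1) (y + e κ) = (wrec L U₀ (expCfg B₀) (j + 1) (y + e κ))⁻¹)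
    (hU : ∀ x μ, avgIter L (mgauge U₀ u (expCfg B₀) * U₀) j x μ ∈ U1 𝔸)
    (hW : avgIter L (mgauge U₀ u (expCfg B₀) * U₀) (j + 1) y κ ∈ U1 𝔸)
    {α₁ : ℝ} (hα : 0 < α₁) (hsmall : (d : ℝ) * L * α₁ ≤ 1 / 8)
    (h135 : ∀ (z : Site d) (μ : Fin d), (L : ℤ) • y ≤ z → z + e μ ≤ (L : ℤ) • y + blockTop L →
      ‖(avgIter L (mgauge U₀ u (expCfg B₀) * U₀) j z μ : 𝔸) - (avgIter L U₀ j z μ : 𝔸)‖ ≤ α₁)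
    (h135b : ‖(avgIter L (mgauge U₀ u (expCfg B₀) * U₀) (j + 1) y κ : 𝔸) - (avgIter L U₀ (j + 1) y κ : 𝔸)‖ ≤ α₁) :
    ‖logCovIter L U₀ B₀ (j + 1) y κ‖ < 2 * d * L * α₁ :=
  norm_Qj_lt_crossing L hd (le_trans (by norm_num) hL) U₀ B₀ u j
    (dbavgCovIter_eq_expCfg_logCovIter L hL hG k U₀ hU₀ hα₀ hα3 hα4 h40 B₀ hb hB hsm hc₃ j (Nat.le_of_succ_le hjk))
    y κ h87 hp hU (level_data L hL hG k U₀ hU₀ hα₀ hα3 hα4 h40 j (Nat.le_of_succ_le hjk)).1 hW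
    ((level_data L hL hG k U₀ hU₀ hα₀ hα3 hα4 h40 (j + 1) hjk).1 y κ) hα hsmall h135 h135b

/-! ## §6 B8 currency `B₀ = iηA` under (1.41): the hypothesis `h42` of `B8Eq156Prop4.norm_B1_lt` discharged from (1.35) -/

omit [NormOneClass 𝔸] [CompleteSpace 𝔸] in
/-- (1.41) «|A| < α₂(Lᵏη)⁻¹» read globally puts `B₀ = iηA` in §5's regime with `Lᵏ·b = α₂`: `sup‖iηA‖ ≤ η·α₂(Lᵏη)⁻¹` and
`Lᵏ·(η·α₂(Lᵏη)⁻¹) = α₂`. [cite: Balaban1985RegularSpaces, (1.41) p.83] -/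
theorem level_scale_of_141 {η : ℝ} (hη : 0 < η) (L : ℕ) (hL : 1 ≤ L) (k : ℕ) (α₂ : ℝ) :
    (L : ℝ) ^ k * (η * (α₂ * ((L : ℝ) ^ k * η)⁻¹)) = α₂ := by
  have hL0 : (0 : ℝ) < (L : ℝ) ^ k := pow_pos (by exact_mod_cast hL) k
  field_simp

/-- **(1.42) «Q_j(U₀, ηA) = B on Λ_j, |B| < 2dLα₁» for the `Q_j` of the Sect. C bootstrap, interior bond**: with `U₁ = e^{iηA}`,
(1.40) `pdev U₀ < α₀L^{−2k}`, (1.41) `|A| ≤ α₂(Lᵏη)⁻¹` (read globally), the smallness of [3] Prop. 4's regime in the form of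
`B8Eq156Prop4.eq156_of_141` (`e^{4cα₀}(1 + 8C₁α₂) ≤ 2`, `2α₂ ≤ c₃`), (87) at `b₋`, `b₊` and (1.35) at `b`:
`‖logCovIter L U₀ (iEta η A) (j+1) y κ‖ < 2dLα₁` — the hypothesis `h42` of `B8Eq156Prop4.norm_B1_lt` at the level `j + 1`.
[cite: Balaban1985RegularSpaces, (1.42) p.83, (1.37) p.82, (1.40)–(1.41) p.83, (1.35) p.82] -/
theorem norm_Qj_lt_interior_of_141 {η : ℝ} (hη : 0 < η) (L : ℕ) (hd : 1 ≤ d) (hL : 2 ≤ L) {G : Subgroup 𝔸ˣ}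
    (hG : AvgClosed d L G) (k : ℕ) (U₀ : Site d → Fin d → 𝔸ˣ) (hU₀ : ∀ x κ, U₀ x κ ∈ G) {α₀ : ℝ} (hα₀ : 0 < α₀)
    (hα3 : C0 d * α₀ ≤ 1 / 3) (hα4 : 4 * α₀ ≤ c2' d L) (h40 : pdev U₀ < α₀ * (((L : ℝ) ^ k)⁻¹) ^ 2)
    (A : Site d → Fin d → 𝔸) {α₂ : ℝ} (hα₂ : 0 ≤ α₂) (h41 : ∀ y κ, ‖A y κ‖ ≤ α₂ * ((L : ℝ) ^ k * η)⁻¹)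
    (hsm : Real.exp (4 * (800 * ((d : ℝ) + 1) ^ 2 * ((d : ℝ) + 4)) * α₀)
      * (1 + 8 * (131072 * ((d : ℝ) + 1) ^ 2) * α₂) ≤ 2)
    (hc₃ : 2 * α₂ ≤ c3 d L) (u : Site d → 𝔸ˣ) {j : ℕ} (hjk : j + 1 ≤ k) (y : Site d) (κ : Fin d)
    (hm : uLev L u (j + 1) y = (wrec L U₀ (expCfg (iEta η A)) (j + 1) y)⁻¹)
    (hp : uLev L u (j + 1) (y + e κ) = (wrec L U₀ (expCfg (iEta η A)) (j + 1) (y + e κ))⁻¹)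
    {α₁ : ℝ} (hα : 0 < α₁) (hsmall : (d : ℝ) * L * α₁ ≤ 1 / 8)
    (h135 : ‖(avgIter L (mgauge U₀ u (expCfg (iEta η A)) * U₀) (j + 1) y κ : 𝔸) - (avgIter L U₀ (j + 1) y κ : 𝔸)‖
      ≤ α₁) :
    ‖logCovIter L U₀ (iEta η A) (j + 1) y κ‖ < 2 * d * L * α₁ := by
  have hL1 : 1 ≤ L := le_trans (by norm_num) hL
  have hsc := level_scale_of_141 hη L hL1 k α₂
  have hb : 0 ≤ η * (α₂ * ((L : ℝ) ^ k * η)⁻¹) :=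
    mul_nonneg hη.le (mul_nonneg hα₂ (inv_nonneg.2 (by positivity)))
  exact norm_Qj_lt_interior_regular L hd hL hG k U₀ hU₀ hα₀ hα3 hα4 h40 (iEta η A) hb (norm_iEta_le hη.le h41)
    (by rw [hsc]; exact hsm) (by rw [hsc]; exact hc₃) u hjk y κ hm hp hα hsmall h135

/-- **The same on a crossing bond** `b₋ ∈ Λ_j`, `b₊ ∈ Λ_{j+1}` ((87) on the block `B(b₋)` and at `b₊`, (1.35) on the bonds of
`B(b₋)` and at `b`, `U1`-valued averages of `U′U₀`): `‖logCovIter L U₀ (iEta η A) (j+1) y κ‖ < 2dLα₁`.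
[cite: Balaban1985RegularSpaces, (1.42) p.83, (1.37) p.82, (1.40)–(1.41) p.83, (1.35) p.82] -/
theorem norm_Qj_lt_crossing_of_141 {η : ℝ} (hη : 0 < η) (L : ℕ) (hd : 1 ≤ d) (hL : 2 ≤ L) {G : Subgroup 𝔸ˣ}
    (hG : AvgClosed d L G) (k : ℕ) (U₀ : Site d → Fin d → 𝔸ˣ) (hU₀ : ∀ x κ, U₀ x κ ∈ G) {α₀ : ℝ} (hα₀ : 0 < α₀)
    (hα3 : C0 d * α₀ ≤ 1 / 3) (hα4 : 4 * α₀ ≤ c2' d L) (h40 : pdev U₀ < α₀ * (((L : ℝ) ^ k)⁻¹) ^ 2)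
    (A : Site d → Fin d → 𝔸) {α₂ : ℝ} (hα₂ : 0 ≤ α₂) (h41 : ∀ y κ, ‖A y κ‖ ≤ α₂ * ((L : ℝ) ^ k * η)⁻¹)
    (hsm : Real.exp (4 * (800 * ((d : ℝ) + 1) ^ 2 * ((d : ℝ) + 4)) * α₀)
      * (1 + 8 * (131072 * ((d : ℝ) + 1) ^ 2) * α₂) ≤ 2)
    (hc₃ : 2 * α₂ ≤ c3 d L) (u : Site d → 𝔸ˣ) {j : ℕ} (hjk : j + 1 ≤ k) (y : Site d) (κ : Fin d)
    (h87 : ∀ x : Site d, InBox ((L : ℤ) • y) ((L : ℤ) • y + blockTop L) x →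
      uLev L u j x = (wrec L U₀ (expCfg (iEta η A)) j x)⁻¹)
    (hp : uLev L u (j + 1) (y + e κ) = (wrec L U₀ (expCfg (iEta η A)) (j + 1) (y + e κ))⁻¹)
    (hU : ∀ x μ, avgIter L (mgauge U₀ u (expCfg (iEta η A)) * U₀) j x μ ∈ U1 𝔸)
    (hW : avgIter L (mgauge U₀ u (expCfg (iEta η A)) * U₀) (j + 1) y κ ∈ U1 𝔸)
    {α₁ : ℝ} (hα : 0 < α₁) (hsmall : (d : ℝ) * L * α₁ ≤ 1 / 8)
    (h135 : ∀ (z : Site d) (μ : Fin d), (L : ℤ) • y ≤ z → z + e μ ≤ (L : ℤ) • y + blockTop L →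
      ‖(avgIter L (mgauge U₀ u (expCfg (iEta η A)) * U₀) j z μ : 𝔸) - (avgIter L U₀ j z μ : 𝔸)‖ ≤ α₁)
    (h135b : ‖(avgIter L (mgauge U₀ u (expCfg (iEta η A)) * U₀) (j + 1) y κ : 𝔸) - (avgIter L U₀ (j + 1) y κ : 𝔸)‖
      ≤ α₁) :
    ‖logCovIter L U₀ (iEta η A) (j + 1) y κ‖ < 2 * d * L * α₁ := by
  have hL1 : 1 ≤ L := le_trans (by norm_num) hL
  have hsc := level_scale_of_141 hη L hL1 k α₂
  have hb : 0 ≤ η * (α₂ * ((L : ℝ) ^ k * η)⁻¹) :=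
    mul_nonneg hη.le (mul_nonneg hα₂ (inv_nonneg.2 (by positivity)))
  exact norm_Qj_lt_crossing_regular L hd hL hG k U₀ hU₀ hα₀ hα3 hα4 h40 (iEta η A) hb (norm_iEta_le hη.le h41)
    (by rw [hsc]; exact hsm) (by rw [hsc]; exact hc₃) u hjk y κ h87 hp hU hW hα hsmall h135 h135b

/-! ## §7 «hence … |B₁| < 2dLα₁ + C₂α₂²» (p. 86) with (1.42) DERIVED: `B8Eq156Prop4.norm_B1_lt` fed by §6 -/

/-- **p. 86 «|B₁| < 2dLα₁ + C₂α₂²» at an interior bond of `Λ_{j+1}`, with the (1.42) input no longer assumed**: p40's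
`B8Eq156Prop4.norm_B1_lt` at the level `j + 1` whose hypothesis `h42` is supplied by `norm_Qj_lt_interior_of_141`
(`k := j + 1`) — i.e. from (1.40), (1.41), (87) at `b₋`, `b₊` and (1.35) at `b`:
`‖L^{j+1}ηQ_{j+1}A(b)‖ < 2dLα₁ + C₂α₂²`, `C₂ = 8C₁e^{4cα₀}`. [cite: Balaban1985RegularSpaces, p.86 (sentence after (1.56)), (1.42) p.83, (1.35) p.82] -/
theorem norm_B1_lt_of_135_interior {η : ℝ} (hη : 0 < η) (L : ℕ) (hd : 1 ≤ d) (hL : 2 ≤ L) {G : Subgroup 𝔸ˣ}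
    (hG : AvgClosed d L G) (j : ℕ) (U₀ : Site d → Fin d → 𝔸ˣ) (hU₀ : ∀ x κ, U₀ x κ ∈ G) {α₀ : ℝ} (hα₀ : 0 < α₀)
    (hα3 : C0 d * α₀ ≤ 1 / 3) (hα4 : 4 * α₀ ≤ c2' d L) (h40 : pdev U₀ < α₀ * (((L : ℝ) ^ (j + 1))⁻¹) ^ 2)
    (A : Site d → Fin d → 𝔸) {α₂ : ℝ} (hα₂ : 0 ≤ α₂) (h41 : ∀ y κ, ‖A y κ‖ ≤ α₂ * ((L : ℝ) ^ (j + 1) * η)⁻¹)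
    (hsm : Real.exp (4 * (800 * ((d : ℝ) + 1) ^ 2 * ((d : ℝ) + 4)) * α₀)
      * (1 + 8 * (131072 * ((d : ℝ) + 1) ^ 2) * α₂) ≤ 2)
    (hc₃ : 2 * α₂ ≤ c3 d L) (u : Site d → 𝔸ˣ) (y : Site d) (κ : Fin d)
    (hm : uLev L u (j + 1) y = (wrec L U₀ (expCfg (iEta η A)) (j + 1) y)⁻¹)
    (hp : uLev L u (j + 1) (y + e κ) = (wrec L U₀ (expCfg (iEta η A)) (j + 1) (y + e κ))⁻¹)
    {α₁ : ℝ} (hα : 0 < α₁) (hsmall : (d : ℝ) * L * α₁ ≤ 1 / 8)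
    (h135 : ‖(avgIter L (mgauge U₀ u (expCfg (iEta η A)) * U₀) (j + 1) y κ : 𝔸) - (avgIter L U₀ (j + 1) y κ : 𝔸)‖
      ≤ α₁) :
    ‖linCovIter L U₀ (iEta η A) (j + 1) y κ‖
      < 2 * d * L * α₁ + 8 * (131072 * ((d : ℝ) + 1) ^ 2)
          * Real.exp (4 * (800 * ((d : ℝ) + 1) ^ 2 * ((d : ℝ) + 4)) * α₀) * α₂ ^ 2 :=
  B8Eq156Prop4.norm_B1_lt hη L hL hG (j + 1) U₀ hU₀ hα₀ hα3 hα4 h40 A hα₂ h41 hsm hc₃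
    (norm_Qj_lt_interior_of_141 hη L hd hL hG (j + 1) U₀ hU₀ hα₀ hα3 hα4 h40 A hα₂ h41 hsm hc₃ u le_rfl y κ hm hp
      hα hsmall h135)

/-- **The same at a crossing bond** `b₋ ∈ Λ_j`, `b₊ ∈ Λ_{j+1}`: `‖L^{j+1}ηQ_{j+1}A(b)‖ < 2dLα₁ + C₂α₂²` from (1.40), (1.41),
(87) on `B(b₋)` and at `b₊`, (1.35) on the bonds of `B(b₋)` and at `b`, `U1`-valued averages of `U′U₀`.
[cite: Balaban1985RegularSpaces, p.86 (sentence after (1.56)), (1.42) p.83, (1.35) p.82] -/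
theorem norm_B1_lt_of_135_crossing {η : ℝ} (hη : 0 < η) (L : ℕ) (hd : 1 ≤ d) (hL : 2 ≤ L) {G : Subgroup 𝔸ˣ}
    (hG : AvgClosed d L G) (j : ℕ) (U₀ : Site d → Fin d → 𝔸ˣ) (hU₀ : ∀ x κ, U₀ x κ ∈ G) {α₀ : ℝ} (hα₀ : 0 < α₀)
    (hα3 : C0 d * α₀ ≤ 1 / 3) (hα4 : 4 * α₀ ≤ c2' d L) (h40 : pdev U₀ < α₀ * (((L : ℝ) ^ (j + 1))⁻¹) ^ 2)
    (A : Site d → Fin d → 𝔸) {α₂ : ℝ} (hα₂ : 0 ≤ α₂) (h41 : ∀ y κ, ‖A y κ‖ ≤ α₂ * ((L : ℝ) ^ (j + 1) * η)⁻¹)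
    (hsm : Real.exp (4 * (800 * ((d : ℝ) + 1) ^ 2 * ((d : ℝ) + 4)) * α₀)
      * (1 + 8 * (131072 * ((d : ℝ) + 1) ^ 2) * α₂) ≤ 2)
    (hc₃ : 2 * α₂ ≤ c3 d L) (u : Site d → 𝔸ˣ) (y : Site d) (κ : Fin d)
    (h87 : ∀ x : Site d, InBox ((L : ℤ) • y) ((L : ℤ) • y + blockTop L) x →
      uLev L u j x = (wrec L U₀ (expCfg (iEta η A)) j x)⁻¹)
    (hp : uLev L u (j + 1) (y + e κ) = (wrec L U₀ (expCfg (iEta η A)) (j + 1) (y + e κ))⁻¹)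
    (hU : ∀ x μ, avgIter L (mgauge U₀ u (expCfg (iEta η A)) * U₀) j x μ ∈ U1 𝔸)
    (hW : avgIter L (mgauge U₀ u (expCfg (iEta η A)) * U₀) (j + 1) y κ ∈ U1 𝔸)
    {α₁ : ℝ} (hα : 0 < α₁) (hsmall : (d : ℝ) * L * α₁ ≤ 1 / 8)
    (h135 : ∀ (z : Site d) (μ : Fin d), (L : ℤ) • y ≤ z → z + e μ ≤ (L : ℤ) • y + blockTop L →
      ‖(avgIter L (mgauge U₀ u (expCfg (iEta η A)) * U₀) j z μ : 𝔸) - (avgIter L U₀ j z μ : 𝔸)‖ ≤ α₁)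
    (h135b : ‖(avgIter L (mgauge U₀ u (expCfg (iEta η A)) * U₀) (j + 1) y κ : 𝔸) - (avgIter L U₀ (j + 1) y κ : 𝔸)‖
      ≤ α₁) :
    ‖linCovIter L U₀ (iEta η A) (j + 1) y κ‖
      < 2 * d * L * α₁ + 8 * (131072 * ((d : ℝ) + 1) ^ 2)
          * Real.exp (4 * (800 * ((d : ℝ) + 1) ^ 2 * ((d : ℝ) + 4)) * α₀) * α₂ ^ 2 :=
  B8Eq156Prop4.norm_B1_lt hη L hL hG (j + 1) U₀ hU₀ hα₀ hα3 hα4 h40 A hα₂ h41 hsm hc₃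
    (norm_Qj_lt_crossing_of_141 hη L hd hL hG (j + 1) U₀ hU₀ hα₀ hα3 hα4 h40 A hα₂ h41 hsm hc₃ u le_rfl y κ h87 hp
      hU hW hα hsmall h135 h135b)

/-! ## §8 (v1.1) «on Λ_j» in the typed classes (1.19) `InAx` / (1.29) `Restr129`: the (87)-hypotheses discharged by
`B8Eq131Derivation.eq87_of_inAx_restr129`, in [3] Prop. 4's regime -/

/-- **(1.37) «Q_j(U₀, ηA) = B on Λ_j», INTERIOR bond of `Λ_{j+1}`, from the TYPED CLASSES**: for `U′U₀ ∈ Ax_k(𝔅_k, U₀)`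
(`B8Eq119TwistedAxial.InAx`, (1.19)), `u` satisfying (1.29) (`Restr129`), `U′ = U₁ᵘ`, `U₁ = e^{B₀}` in [3] Prop. 4's regime
(as in `Qj_eq_Bint_regular`), and a level-`(j+1)` bond `b = ⟨y, y + e_κ⟩` with BOTH end-points in `Λ_{j+1}`, `j + 1 ≤ k`:
`Q_{j+1}(U₀, ηA)_b = i·B_b`, `B_b = (1/i) log Ũ′^{j+1}_b` — (87) at `b₋`, `b₊` by `B8Eq131Derivation.eq87_of_inAx_restr129`.
[cite: Balaban1985RegularSpaces, (1.37) p.82, (1.19) p.79, (1.29) p.81; Balaban1985Averaging, (87) p.31, (127) p.37] -/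
theorem Qj_eq_Bint_of_inAx_restr129 (L : ℕ) (hL : 2 ≤ L) {G : Subgroup 𝔸ˣ} (hG : AvgClosed d L G) (k : ℕ)
    (Λ : ℕ → Set (Site d)) (U₀ : Site d → Fin d → 𝔸ˣ) (hU₀ : ∀ x κ, U₀ x κ ∈ G) {α₀ : ℝ} (hα₀ : 0 < α₀)
    (hα3 : C0 d * α₀ ≤ 1 / 3) (hα4 : 4 * α₀ ≤ c2' d L) (h40 : pdev U₀ < α₀ * (((L : ℝ) ^ k)⁻¹) ^ 2)
    (B₀ : Site d → Fin d → 𝔸) {b : ℝ} (hb : 0 ≤ b) (hB : ∀ x κ, ‖B₀ x κ‖ ≤ b)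
    (hsm : Real.exp (4 * (800 * ((d : ℝ) + 1) ^ 2 * ((d : ℝ) + 4)) * α₀)
      * (1 + 8 * (131072 * ((d : ℝ) + 1) ^ 2) * ((L : ℝ) ^ k * b)) ≤ 2)
    (hc₃ : 2 * ((L : ℝ) ^ k * b) ≤ c3 d L) (u : Site d → 𝔸ˣ)
    (hAx : InAx L k Λ U₀ (mgauge U₀ u (expCfg B₀) * U₀)) (h129 : Restr129 L k Λ U₀ u)
    {j : ℕ} (hjk : j + 1 ≤ k) (y : Site d) (κ : Fin d) (hy : y ∈ Λ (j + 1)) (hyκ : y + e κ ∈ Λ (j + 1)) :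
    logCovIter L U₀ B₀ (j + 1) y κ = I • Bint (tildIter L U₀ (mgauge U₀ u (expCfg B₀)) (j + 1) y κ) :=
  have hL1 : 1 ≤ L := le_trans (by norm_num) hL
  have h87 := eq87_of_inAx_restr129 L hL1 k Λ U₀ (expCfg B₀) u hAx h129
  Qj_eq_Bint_regular L hL hG k U₀ hU₀ hα₀ hα3 hα4 h40 B₀ hb hB hsm hc₃ u (Nat.le_of_succ_le hjk) y κ
    (h87 (j + 1) hjk y hy) (h87 (j + 1) hjk (y + e κ) hyκ)

omit [NormOneClass 𝔸] in
/-- **Level `0`** (`Λ₀`, (1.14)): both end-points of `b` in `Λ₀` ⇒ `Q₀(U₀, ηA)_b = ηA_b = i·B_b`, `B_b = (1/i) log U′_b`.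
[cite: Balaban1985RegularSpaces, (1.37) p.82, (1.14) p.78, (1.29) p.81] -/
theorem Qj_eq_Bint_zero_of_inAx_restr129 (L : ℕ) (hL : 1 ≤ L) (k : ℕ) (Λ : ℕ → Set (Site d))
    (U₀ : Site d → Fin d → 𝔸ˣ) (B₀ : Site d → Fin d → 𝔸) {b : ℝ} (hB : ∀ x κ, ‖B₀ x κ‖ ≤ b)
    (hc₃ : 2 * ((L : ℝ) ^ k * b) ≤ c3 d L) (u : Site d → 𝔸ˣ)
    (hAx : InAx L k Λ U₀ (mgauge U₀ u (expCfg B₀) * U₀)) (h129 : Restr129 L k Λ U₀ u)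
    (y : Site d) (κ : Fin d) (hy : y ∈ Λ 0) (hyκ : y + e κ ∈ Λ 0) :
    logCovIter L U₀ B₀ 0 y κ = I • Bint (tildIter L U₀ (mgauge U₀ u (expCfg B₀)) 0 y κ) :=
  have h87 := eq87_of_inAx_restr129 L hL k Λ U₀ (expCfg B₀) u hAx h129
  Qj_eq_Bint_zero_regular L hL k U₀ B₀ hB hc₃ u y κ (h87 0 (Nat.zero_le k) y hy) (h87 0 (Nat.zero_le k) (y + e κ) hyκ)

/-- **(1.37), CROSSING bond `b₋ ∈ Λ_j`, `b₊ ∈ Λ_{j+1}`, from the TYPED CLASSES**: print's «All sites of the contours Γ_{b₋,x}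
belong to Λ_{j−1}» (p. 82) is the hypothesis `hblock` (every level-`j` site of the block `B(b₋)` under `b₋` lies in `Λ_j`),
`b₊ ∈ Λ_{j+1}`; then `Q_{j+1}(U₀, ηA)_b = i·B_b` with the crossing-bond `B_b` of (1.31).
[cite: Balaban1985RegularSpaces, (1.37) p.82, (1.31) p.82, p.82 («All sites of the contours Γ_{b₋,x} belong to Λ_{j−1}»), (1.19) p.79, (1.29) p.81] -/
theorem Qj_eq_Bcross_of_inAx_restr129 (L : ℕ) (hL : 2 ≤ L) {G : Subgroup 𝔸ˣ} (hG : AvgClosed d L G) (k : ℕ)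
    (Λ : ℕ → Set (Site d)) (U₀ : Site d → Fin d → 𝔸ˣ) (hU₀ : ∀ x κ, U₀ x κ ∈ G) {α₀ : ℝ} (hα₀ : 0 < α₀)
    (hα3 : C0 d * α₀ ≤ 1 / 3) (hα4 : 4 * α₀ ≤ c2' d L) (h40 : pdev U₀ < α₀ * (((L : ℝ) ^ k)⁻¹) ^ 2)
    (B₀ : Site d → Fin d → 𝔸) {b : ℝ} (hb : 0 ≤ b) (hB : ∀ x κ, ‖B₀ x κ‖ ≤ b)
    (hsm : Real.exp (4 * (800 * ((d : ℝ) + 1) ^ 2 * ((d : ℝ) + 4)) * α₀)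
      * (1 + 8 * (131072 * ((d : ℝ) + 1) ^ 2) * ((L : ℝ) ^ k * b)) ≤ 2)
    (hc₃ : 2 * ((L : ℝ) ^ k * b) ≤ c3 d L) (u : Site d → 𝔸ˣ)
    (hAx : InAx L k Λ U₀ (mgauge U₀ u (expCfg B₀) * U₀)) (h129 : Restr129 L k Λ U₀ u)
    {j : ℕ} (hjk : j + 1 ≤ k) (y : Site d) (κ : Fin d)
    (hblock : ∀ x : Site d, InBox ((L : ℤ) • y) ((L : ℤ) • y + blockTop L) x → x ∈ Λ j)
    (hyκ : y + e κ ∈ Λ (j + 1)) :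
    logCovIter L U₀ B₀ (j + 1) y κ
      = I • Bcross L (avgIter L U₀ j) (tildIter L U₀ (mgauge U₀ u (expCfg B₀)) j) ((L : ℤ) • y)
          (tildIter L U₀ (mgauge U₀ u (expCfg B₀)) (j + 1) y κ) :=
  have hL1 : 1 ≤ L := le_trans (by norm_num) hL
  have h87 := eq87_of_inAx_restr129 L hL1 k Λ U₀ (expCfg B₀) u hAx h129
  Qj_eq_Bcross_regular L hL hG k U₀ hU₀ hα₀ hα3 hα4 h40 B₀ hb hB hsm hc₃ u (Nat.le_of_succ_le hjk) y κ
    (fun x hx => h87 j (Nat.le_of_succ_le hjk) x (hblock x hx)) (h87 (j + 1) hjk (y + e κ) hyκ)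

/-- **(1.37), MIRRORED crossing bond `b₋ ∈ Λ_{j+1}`, `b₊ ∈ Λ_j`, from the TYPED CLASSES** (`b₋ ∈ Λ_{j+1}`, the block under
`b₊` inside `Λ_j`). [cite: Balaban1985RegularSpaces, (1.37) p.82, (1.31) p.82, (1.19) p.79, (1.29) p.81] -/
theorem Qj_eq_BcrossMirror_of_inAx_restr129 (L : ℕ) (hL : 2 ≤ L) {G : Subgroup 𝔸ˣ} (hG : AvgClosed d L G) (k : ℕ)
    (Λ : ℕ → Set (Site d)) (U₀ : Site d → Fin d → 𝔸ˣ) (hU₀ : ∀ x κ, U₀ x κ ∈ G) {α₀ : ℝ} (hα₀ : 0 < α₀)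
    (hα3 : C0 d * α₀ ≤ 1 / 3) (hα4 : 4 * α₀ ≤ c2' d L) (h40 : pdev U₀ < α₀ * (((L : ℝ) ^ k)⁻¹) ^ 2)
    (B₀ : Site d → Fin d → 𝔸) {b : ℝ} (hb : 0 ≤ b) (hB : ∀ x κ, ‖B₀ x κ‖ ≤ b)
    (hsm : Real.exp (4 * (800 * ((d : ℝ) + 1) ^ 2 * ((d : ℝ) + 4)) * α₀)
      * (1 + 8 * (131072 * ((d : ℝ) + 1) ^ 2) * ((L : ℝ) ^ k * b)) ≤ 2)
    (hc₃ : 2 * ((L : ℝ) ^ k * b) ≤ c3 d L) (u : Site d → 𝔸ˣ)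
    (hAx : InAx L k Λ U₀ (mgauge U₀ u (expCfg B₀) * U₀)) (h129 : Restr129 L k Λ U₀ u)
    {j : ℕ} (hjk : j + 1 ≤ k) (y : Site d) (κ : Fin d) (hy : y ∈ Λ (j + 1))
    (hblock : ∀ x : Site d, InBox ((L : ℤ) • (y + e κ)) ((L : ℤ) • (y + e κ) + blockTop L) x → x ∈ Λ j) :
    logCovIter L U₀ B₀ (j + 1) y κ
      = I • BcrossMirror L (avgIter L U₀ j) (tildIter L U₀ (mgauge U₀ u (expCfg B₀)) j) ((L : ℤ) • (y + e κ))
          (avgIter L U₀ (j + 1) y κ) (tildIter L U₀ (mgauge U₀ u (expCfg B₀)) (j + 1) y κ) :=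
  have hL1 : 1 ≤ L := le_trans (by norm_num) hL
  have h87 := eq87_of_inAx_restr129 L hL1 k Λ U₀ (expCfg B₀) u hAx h129
  Qj_eq_BcrossMirror_regular L hL hG k U₀ hU₀ hα₀ hα3 hα4 h40 B₀ hb hB hsm hc₃ u (Nat.le_of_succ_le hjk) y κ
    (h87 (j + 1) hjk y hy) (fun x hx => h87 j (Nat.le_of_succ_le hjk) x (hblock x hx))

/-- **(1.42) clause «|Q_j(U₀, ηA)| < 2dLα₁» from (1.35), INTERIOR bond of `Λ_{j+1}`, from the TYPED CLASSES** (`d ≥ 1`,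
`0 < α₁`, `dLα₁ ≤ 1/8`, (1.35) at `b`). [cite: Balaban1985RegularSpaces, (1.42) p.83, (1.37) p.82, (1.35) p.82, (1.19) p.79, (1.29) p.81] -/
theorem norm_Qj_lt_interior_of_inAx_restr129 (L : ℕ) (hd : 1 ≤ d) (hL : 2 ≤ L) {G : Subgroup 𝔸ˣ}
    (hG : AvgClosed d L G) (k : ℕ) (Λ : ℕ → Set (Site d)) (U₀ : Site d → Fin d → 𝔸ˣ) (hU₀ : ∀ x κ, U₀ x κ ∈ G)
    {α₀ : ℝ} (hα₀ : 0 < α₀) (hα3 : C0 d * α₀ ≤ 1 / 3) (hα4 : 4 * α₀ ≤ c2' d L)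
    (h40 : pdev U₀ < α₀ * (((L : ℝ) ^ k)⁻¹) ^ 2) (B₀ : Site d → Fin d → 𝔸) {b : ℝ} (hb : 0 ≤ b)
    (hB : ∀ x κ, ‖B₀ x κ‖ ≤ b)
    (hsm : Real.exp (4 * (800 * ((d : ℝ) + 1) ^ 2 * ((d : ℝ) + 4)) * α₀)
      * (1 + 8 * (131072 * ((d : ℝ) + 1) ^ 2) * ((L : ℝ) ^ k * b)) ≤ 2)
    (hc₃ : 2 * ((L : ℝ) ^ k * b) ≤ c3 d L) (u : Site d → 𝔸ˣ)
    (hAx : InAx L k Λ U₀ (mgauge U₀ u (expCfg B₀) * U₀)) (h129 : Restr129 L k Λ U₀ u)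
    {j : ℕ} (hjk : j + 1 ≤ k) (y : Site d) (κ : Fin d) (hy : y ∈ Λ (j + 1)) (hyκ : y + e κ ∈ Λ (j + 1))
    {α₁ : ℝ} (hα : 0 < α₁) (hsmall : (d : ℝ) * L * α₁ ≤ 1 / 8)
    (h135 : ‖(avgIter L (mgauge U₀ u (expCfg B₀) * U₀) (j + 1) y κ : 𝔸) - (avgIter L U₀ (j + 1) y κ : 𝔸)‖ ≤ α₁) :
    ‖logCovIter L U₀ B₀ (j + 1) y κ‖ < 2 * d * L * α₁ :=
  have hL1 : 1 ≤ L := le_trans (by norm_num) hL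
  have h87 := eq87_of_inAx_restr129 L hL1 k Λ U₀ (expCfg B₀) u hAx h129
  norm_Qj_lt_interior_regular L hd hL hG k U₀ hU₀ hα₀ hα3 hα4 h40 B₀ hb hB hsm hc₃ u hjk y κ (h87 (j + 1) hjk y hy)
    (h87 (j + 1) hjk (y + e κ) hyκ) hα hsmall h135

/-- **(1.42) clause from (1.35), CROSSING bond `b₋ ∈ Λ_j`, `b₊ ∈ Λ_{j+1}`, from the TYPED CLASSES** ((1.35) on the bonds of
`B(b₋)` and at `b`; `U1`-valued averages of `U′U₀` = print's `U′U₀ ∈ 𝔄_k` side, [3] Prop. 2).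
[cite: Balaban1985RegularSpaces, (1.42) p.83, (1.37) p.82, (1.35) p.82, (1.19) p.79, (1.29) p.81] -/
theorem norm_Qj_lt_crossing_of_inAx_restr129 (L : ℕ) (hd : 1 ≤ d) (hL : 2 ≤ L) {G : Subgroup 𝔸ˣ}
    (hG : AvgClosed d L G) (k : ℕ) (Λ : ℕ → Set (Site d)) (U₀ : Site d → Fin d → 𝔸ˣ) (hU₀ : ∀ x κ, U₀ x κ ∈ G)
    {α₀ : ℝ} (hα₀ : 0 < α₀) (hα3 : C0 d * α₀ ≤ 1 / 3) (hα4 : 4 * α₀ ≤ c2' d L)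
    (h40 : pdev U₀ < α₀ * (((L : ℝ) ^ k)⁻¹) ^ 2) (B₀ : Site d → Fin d → 𝔸) {b : ℝ} (hb : 0 ≤ b)
    (hB : ∀ x κ, ‖B₀ x κ‖ ≤ b)
    (hsm : Real.exp (4 * (800 * ((d : ℝ) + 1) ^ 2 * ((d : ℝ) + 4)) * α₀)
      * (1 + 8 * (131072 * ((d : ℝ) + 1) ^ 2) * ((L : ℝ) ^ k * b)) ≤ 2)
    (hc₃ : 2 * ((L : ℝ) ^ k * b) ≤ c3 d L) (u : Site d → 𝔸ˣ)
    (hAx : InAx L k Λ U₀ (mgauge U₀ u (expCfg B₀) * U₀)) (h129 : Restr129 L k Λ U₀ u)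
    {j : ℕ} (hjk : j + 1 ≤ k) (y : Site d) (κ : Fin d)
    (hblock : ∀ x : Site d, InBox ((L : ℤ) • y) ((L : ℤ) • y + blockTop L) x → x ∈ Λ j)
    (hyκ : y + e κ ∈ Λ (j + 1))
    (hU : ∀ x μ, avgIter L (mgauge U₀ u (expCfg B₀) * U₀) j x μ ∈ U1 𝔸)
    (hW : avgIter L (mgauge U₀ u (expCfg B₀) * U₀) (j + 1) y κ ∈ U1 𝔸)
    {α₁ : ℝ} (hα : 0 < α₁) (hsmall : (d : ℝ) * L * α₁ ≤ 1 / 8)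
    (h135 : ∀ (z : Site d) (μ : Fin d), (L : ℤ) • y ≤ z → z + e μ ≤ (L : ℤ) • y + blockTop L →
      ‖(avgIter L (mgauge U₀ u (expCfg B₀) * U₀) j z μ : 𝔸) - (avgIter L U₀ j z μ : 𝔸)‖ ≤ α₁)
    (h135b : ‖(avgIter L (mgauge U₀ u (expCfg B₀) * U₀) (j + 1) y κ : 𝔸) - (avgIter L U₀ (j + 1) y κ : 𝔸)‖ ≤ α₁) :
    ‖logCovIter L U₀ B₀ (j + 1) y κ‖ < 2 * d * L * α₁ :=
  have hL1 : 1 ≤ L := le_trans (by norm_num) hL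
  have h87 := eq87_of_inAx_restr129 L hL1 k Λ U₀ (expCfg B₀) u hAx h129
  norm_Qj_lt_crossing_regular L hd hL hG k U₀ hU₀ hα₀ hα3 hα4 h40 B₀ hb hB hsm hc₃ u hjk y κ
    (fun x hx => h87 j (Nat.le_of_succ_le hjk) x (hblock x hx)) (h87 (j + 1) hjk (y + e κ) hyκ) hU hW hα hsmall
    h135 h135b

end Literature.MathematicalPhysics.QuantumFieldTheory.Balaban1983to89.B8Eq137QjEqB

end
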